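import Mathlib
import HarnessLib
import HarnessLib.Audit
import Summits.CriticalPhenomena.Statement
import Literature.Probability.RandomPlanarGeometry.SLEConvergenceCriterion
import Literature.Probability.RandomPlanarGeometry.JordanIndexOne
import Literature.Probability.RandomPlanarGeometry.SLEKappaRhoSchrammObservable
import Literature.Probability.RandomPlanarGeometry.SLELawOfDrivingProcess
import Literature.Probability.LatticeModels.LatticeLaplacian
import Literature.Probability.RandomPlanarGeometry.SLEUniquenessInLaw
import Literature.Probability.RandomPlanarGeometry.SAWCount
import HarnessLib.Audit.Status.Attr

/-!
Route: SAWSchrammPassage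

DORMANT since 2026-08-26T04:21:58Z (reconciler: no traction for 8.3 d (last activity item-evidence-added at 2026-08-17T19:24:59Z); parked, not closed — `ledger route dormant route-CriticalPhenomena-SAWSchrammPassage --off` to reactivate) — unstaffed, not closed; items shared with open routes are served there. `ledger route dormant <id> --off` reactivates.

# Route SAWSchrammPassage — Schramm's left-passage probability as a phase-free exact SAW martingale;
the turning identity Δh = −E[turning] makes its limit a linear Schrödinger BVP singling out κ = 8/3

It suffices to show X_E = (TC) ∧ (TC ⇒ SPU) ∧ (SPU ⇒ I) ∧ (T), realising card excursion-current-laws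
(its law (L1) in integrated form and its
turning identity). Objects: for the critical x_c-SAW γ from p to q in a discrete domain, the SIDE
field h_δ(z) = P(z lies on the arc-1 side of γ)
(typed as the winding of the closed loop "SAW polyline + segment + boundary arc 1 + segment" about z
being ≠ 0) — a [0,1]-valued one-point
function which is an EXACT bounded martingale under exploration (tower property; no tip factor, no
winding phase, no normalisation).
 (TC) TurningClosure: the exact lattice identity Δ_δ h_δ(face) = −E[net ccw quarter-turns of γ
around the face] closes linearly in the limit:
      Σ_faces h_δ Δ_δψ + (π²/2) ψ |∇_δ ω|² (2h_δ − 1) → 0 for every C²_c test function ψ, ω =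
arg(Φ⁻¹)/π the harmonic measure of a boundary arc,
      uniformly over CELL DOMAINS (interiors of unions of δ-octagonal cells around a finite S ⊂ ℤ²,
marked at side midpoints of boundary-adjacent
      p, q ∈ S — a class containing every SAW-slit domain) — "h_δ is an approximate solution of (Δ +
π²|∇ω|²)(2h − 1) = 0".
 (TC ⇒ SPU) ClosureToSchramm: weak closure + boundary values + positivity 0 ≤ h ≤ 1 (which kills the
reflection-odd zero mode B sin(πω):
      sup(−cos πω + B sin πω) = √(1+B²) ≤ 1 forces B = 0) ⇒ SchrammPassageUniform: |h_δ(z) − (1 −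
index(z)·cos arg Φ⁻¹(z))/2| ≤ ε as soon as z has
      N(ε) lattice cells of room, uniformly over cell domains = Schramm's κ = 8/3 percolation
formula P(pass left of re^{iθ}) = cos²(θ/2) for the ℤ² SAW.
 (SPU ⇒ I) SchrammIdentifies: the uniform Schramm passage identifies every subsequential limit as
chordal SLE_{8/3} (shared item SubseqIdentification,
      stmt-CriticalPhenomena-0783): Kemppainen–Smirnov regularity + passage of the exact discrete
martingale to the limit + the far-field expansion of
      Schramm's observable cos arg(g_t(z) − W_t) = cos φ − W_t sin²φ/R + sin²φ cos φ (4t −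
(3/2)W_t²)/R² + O(R⁻³), whose coefficients make W_t and
      W_t² − (8/3)t martingales (support SchrammCharacterisesSLE, the converse of the tree's
martingale_schrammObsStopped_sle).
 (T) EventualTight (shared item stmt-CriticalPhenomena-1881, the repaired eventual form of the
refuted stmt-0772).
Then the PROVED criterion convergesInLawToSLE_of_isTightAlongMesh with IsSLECurve.map_eq_holds gives
SAWScalingLimit.
Lean: `TurningClosure ∧ ClosureToSchramm ∧ SchrammIdentifies ∧ EventualTight`

## Assembly
From h₁ : TurningClosure and h₂ : ClosureToSchramm get SchrammPassageUniform; h₃ : SchrammIdentifies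
turns it into SubseqIdentification; with
h₄ : EventualTight, for each (D, a, b) with IsEndpointApprox the laws are eventually probability
measures (IsEndpointApprox.reachable, finiteness of
DomainSAW), and the PROVED criterion
Literature.Probability.RandomPlanarGeometry.convergesInLawToSLE_of_isTightAlongMesh (uniqueness
IsSLECurve.map_eq_holds, a.e.-measurability SAW.aemeasurable_curve, SubseqIdentification read
through IsSubseqLimitLaw) gives ConvergesInLawToSLE (8/3),
i.e. SAWScalingLimit — the same final step as the assembly of route SAWLeftRightFKG (stmt-1885).

Rationale: WHY THIS LINE. Every interface→SLE proof runs a discrete martingale observable through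
Kemppainen–Smirnov precompactness (KemppainenSmirnov2017, CDHKSCRAS2014); for
the SAW the only candidate in play is the Duminil-Copin–Smirnov parafermion (route SAWParafermion,
DuminilCopinSmirnov2012 Conj. 2), a complex
partition-function sum with a winding phase, no ℤ² vertex relation
(Literature.Barriers.CriticalPhenomena.NienhuisWeightsExcludeVertexSAW) and a
boundary normalisation problem (KennedyLawler2013). This line replaces it by the softest positive
observable there is — Schramm's left-passage
probability (Schramm2001Percolation Thm 2; at κ = 8/3 the hypergeometric collapses to cos²(θ/2),
Monte-Carlo-confirmed for the SAW by Kennedy2002,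
Kennedy2004) — whose lattice version is an exact bounded martingale by the tower property alone,
exactly as harmonic measure is for the harmonic
explorer at κ = 4 (SchrammSheffield2005); imported areas: SLE martingale identification
(Schramm–Sheffield / CDHKS, transplanted from κ = 4 and
κ = 3, 16/3 to κ = 8/3 with an explicit far-field expansion), discrete potential theory (the curl
identity Δ_δh_δ = −E[turning] turns identification
into a LINEAR local-closure problem for a Schrödinger operator Δ + π²|∇ω|², κ = 8/3 being the unique
κ ≠ 4 where Schramm's F_κ solves a linear ODE),
and elliptic uniqueness with a positivity trick for the zero mode. What prior routes do not do: no
partition function, no phase, no conformal map in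
the lattice object (the map enters only the limit value), and the cruxes are stated uniformly over a
slit-stable class of cell domains so that the
martingale passage is an honest implication; the negatives index (stmt-0772) is avoided by using
only eventual tightness.

RANKED CRUXES. #2 TurningClosure (crux) — card item TurningClosure in weak form: for ψ ∈ C²_c and
every cell domain D (carrier = interior of the union of δ-cells |x|,|y| ≤ δ/2, |x|+|y| ≤ 9δ/10
around S ∋ p, q, marks at the side midpoints towards exterior neighbours p', q', Φ any chordal
uniformizer) containing the r-neighbourhood of supp ψ, the face sums Σ_f H_f Δ_δΨ_f + ½ Ψ_f E_f
(2H_f − 1) are ≤ ε for δ ≤ δ₀(ψ, ε, r), where H_f = side probability of the face centre, Ψ_f =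
ψ(centre), E_f = π²|∇_δ(arg Φ⁻¹/π)|²(f); side-symmetric (h ↦ 1 − h leaves it invariant), so no
orientation enters. [difficulty: open-problem] (why it might fail: Necessary for Schramm's formula
(false iff the SAW side law is not the κ=8/3 one); as a MECHANISM it needs a local linear-response
law 'mean turning = (π²/2)|∇ω|²(2h−1)' with NO lattice correction factor — a KennedyLawler2013-type
lattice constant ≠ 1 in the bulk breaks the closure.) [Schramm2001Percolation, Kennedy2002,
KennedyLawler2013, SchrammSheffield2005,
Summits/CriticalPhenomena/SAWScalingLimit/Ideas/excursion-current-laws.md]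
#3 SchrammPassageUniform (crux) — Schramm's κ = 8/3 formula for the critical ℤ² SAW, uniformly over
cell domains: for every ε there is N such that for every mesh δ, finite S ⊂ ℤ², boundary-adjacent p,
q ∈ S with exterior neighbours p', q', Jordan D with carrier the cell domain of S and marks at the
two side midpoints, chordal uniformizer Φ (0 ↦ pt 0, ∞ ↦ pt 1) and z with N δ ≤ dist(z, ∂D), ‖Φ⁻¹z‖
= 1: |P_δ[wind(loop_γ, z) ≠ 0] − (1 − index_D(z)·Re Φ⁻¹(z))/2| ≤ ε (index = ±1 fixes which bank arc
1 is; cos arg = Re at modulus 1). [difficulty: open-problem] (why it might fail: It is conformal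
invariance of the SAW one-point side law (open even on the hexagonal lattice); uniformity asks N(ε)
cells of room at z ONLY — a domain whose bottlenecks/fjords at lattice scale bias the walk
macroscopically, or interior-vs-boundary start effects, would break the uniform form first.)
[Schramm2001Percolation, Kennedy2002, Kennedy2004, LawlerSchrammWerner2004SAW,
KemppainenSmirnov2017, Beffara2008]
#4 ClosureToSchramm (crux) — the weak turning closure implies the uniform Schramm passage: weak-*
limits of h_δ along any sequence of cell domains (Carathéodory-normalised at z) solve (Δ +
π²|∇ω|²)(2h − 1) = 0 in D'(Ω); boundary values h → 1/0 at the two arcs (a SAW boundary-proximity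
estimate) and 0 ≤ h ≤ 1 force, after transport to ℍ and separation of variables (modes sin mθ ·
r^{±√(m²−1)} unbounded for m ≥ 2, zero mode B sin θ excluded by √(1+B²) ≤ 1), h = (1 − cos θ)/2;
equicontinuity of h_δ in z upgrades weak to uniform convergence. [deps: TurningClosure,
SchrammPassageUniform] [difficulty: L] (why it might fail: Needs two a-priori SAW inputs not in
print: boundary values (the walk separates z from a nearby arc with small probability — a
Beurling-type estimate at x_c) and equicontinuity of h_δ (P[γ through a mesoscopic ball] → 0, a
one-arm bound); without them weak solutions need not be the pointwise limit.)
[Schramm2001Percolation, DuminilCopinHammond2013, MadrasSlade1993, Lawler2005]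
#4a–c DECOMPOSED (crux-strategist 2026-08-17, BC2 redirect of the RESTATED deciding crux; route rev
2–4): ClosureToSchramm is now DERIVED in `closes` from three typed pieces through the glue item
ClosureToSchrammOfPieces (support, stmt-17594; proof closureToSchramm_of_subs DONE —
Cruxes/ClosureToSchramm/SplitGlue(ByName).lean, 635 lines, rc 0, 0 sorry: normalise each cell
configuration by the lattice similarity σx = (x − δv₀)/d, apply the pieces and TurningClosure to the
IMAGE configuration, transport back by the exact similarity covariance of the side field, the Jordan
index and the uniformizer; awaiting a prover to land it verbatim, Theorems being prover-only). #4a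
SideFieldEquicontinuity (crux, rank 4, stmt-17593) — macroscopic equicontinuity of h_δ, uniformly
over cell configurations: |h_δ(x) − h_δ(x')| ≤ e once x has N(e) cells of room and ‖x' − x‖ ≤
ρ(e)·dist(x,∂D); = the interior ONE-ARM bound P_δ[γ visits B(x, ρ·dist)] → 0 (birth skeleton:
stub_oneArm + Rouché stub_windStable ⇒ proved composition). (why it might fail: no uniform one-arm
decay is proved for the x_c-SAW in a domain; a geometry steering the walk through B(x, ρ·dist).)
[LawlerSchrammWerner2002OneArm, LawlerSchrammWerner2004SAW, DuminilCopinHammond2013] #4b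
ArcBoundaryValues (crux, rank 5, stmt-17592) — Beurling-type boundary values, uniformly: h_δ(x)
within e of Schramm's value when x has N(e) cells of room and arg Φ⁻¹x ∉ (η(e), π − η(e)) (birth
skeleton: the two one-sided estimates stub_nearArcZero / stub_nearArcPi ⇒ proved composition via
index = ±1 and 1 − cos θ ≤ θ²/2). (why it might fail: no boundary-proximity estimate for the
x_c-SAW; lattice-width fjords at the adjacent arc or p, q conformally close to x.)
[LawlerSchrammWerner2004SAW, Kesten1987, MadrasSlade1993] #4c SchrodingerStability (crux, rank 6,
stmt-19046) — the PURE-ANALYSIS half in normal position with finite test data: for all moduli and ε,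
finitely many ψᵢ, r, η, N such that every H : ℂ → [0,1] with Schramm boundary values (modulus ηB,
NB), macroscopic equicontinuity (ρE, NE) and discrete weak sums ≤ η for the ψᵢ satisfies |H z − (1 −
index·Re Φ⁻¹z)/2| ≤ ε at dist(z,∂D) = 1, ‖Φ⁻¹z‖ = 1, ‖z‖ ≤ δ ≤ 1/N; provable now (compactness:
Koebe/Montel/Carathéodory kernel/Arzelà–Ascoli + uniqueness of bounded weak solutions of u_tt + u_θθ
+ u = 0 on ℝ×(0,π), zero mode killed by |u| ≤ 1; birth skeleton stub_stripUniqueness +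
stub_compactness). (why it might fail: the finite-data / normal-position typing must follow from
compactness — analysis only, not in print.) [Schramm2001Percolation, Pommerenke1992, Lawler2005,
GilbargTrudinger2001] BC2 probes Xᵢ → SAWScalingLimit and Xᵢ → ClosureToSchramm fail for all three
(exact?/simpa/aesop; Cruxes/ClosureToSchramm/BC2-PROBES.md).
#5 SchrammIdentifies (crux) — uniform Schramm passage ⇒ identification of every subsequential weak
limit of the critical SAW laws in (Ω_δ; a_δ, b_δ) as the chordal SLE_{8/3} law (the shared
SubseqIdentification): (i) Kemppainen–Smirnov data for the SAW (describability of limits, driver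
convergence; Condition G2), (ii) the exact discrete martingale h_δ(z | γ[0,n]) = side probability in
the slit cell domain ≈ Schramm functional of the discrete driver (by SPU, slit domains being cell
domains), (iii) passage to the limit for the time-limited Schramm functional and (iv)
SchrammCharacterisesSLE. [deps: SchrammPassageUniform, SubseqIdentification,
SchrammCharacterisesSLE] [difficulty: XL] (why it might fail: Step (i) is Kemppainen–Smirnov
Condition G2 for the critical SAW — no FKG/RSW, open (KS17 §4 covers FK, percolation, HE, LERW
only); interior starting points allowed by IsEndpointApprox need a completion-to-the-boundary
argument before any Loewner description exists.) [KemppainenSmirnov2017, CDHKSCRAS2014,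
SchrammSheffield2005, Schramm2001Percolation, DuminilCopinHammond2013]
#9 SchrammPassage (support) — the pointwise physical statement (cheapest-falsifier form; Kennedy's
simulations): for every Dobrushin (Jordan) domain D, chordal uniformizer Φ, endpoint approximation
(a_δ, b_δ) and z ∈ Ω, P_δ[z enclosed by SAW polyline + [b_δ, b] + arc 1 + [a, a_δ]] → (1 −
index_D(z)·cos arg Φ⁻¹(z))/2 as δ → 0⁺ (= sin²(θ/2) for the left bank, Schramm's cos²(θ/2) for the
right bank). Follows from SchrammPassageUniform by Carathéodory kernel convergence of the cell
domains of Ω_δ to Ω; its negation kills the line. [difficulty: open-problem]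
[Schramm2001Percolation, Kennedy2002, Kennedy2004, Pommerenke1992]
#9 SchrammCharacterisesSLE (support) — converse of Schramm's martingale (continuum, provable now
with the tree's far-field/localisation machinery): if ν is a probability law on curve classes a.e.
driven through a chordal uniformizer φ of (D; a, b) by a continuous process W (W₀ = 0, measurable
marginals) and for every z ∈ ℍ the time-limited Schramm observable S_{t ∧ Im(z)²/9}(z) = (1 + Re
z_t/|z_t|)/2 satisfies the cylinder identity E_ν[(S_t − S_s) ψ(W_S)] = 0, then ν is the chordal
SLE_{8/3} law: far-field expansion at z = R e^{iπ/4} gives W_t and W_t² − (8/3)t local martingales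
(on the imaginary axis the second-order coefficient sin²φ cos φ vanishes, so off-axis points or
third order −2∫W ds + W³/2 − 2tW are needed), then isSLELaw_of_isLocalMartingale_driving_of_lt_four
(PROVED, κ = 8/3 < 4). [difficulty: M] [Schramm2001Percolation, CDHKSCRAS2014, RohdeSchramm2005,
Literature.Probability.RandomPlanarGeometry.martingale_schrammObsStopped_sle,
Literature.Probability.RandomPlanarGeometry.isSLELaw_of_isLocalMartingale_driving_of_lt_four]
#9 SubseqIdentification (support) — shared item stmt-CriticalPhenomena-0783 (verbatim signature;
crux of routes SAWParafermion / SAWLeftRightFKG): every subsequential weak limit of the critical SAW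
laws along δ_n → 0⁺ is the chordal SLE_{8/3} law. Here it is the CONCLUSION of SchrammIdentifies,
filed so the assembly and the other routes share one decl. [difficulty: open-problem]
[LawlerSchrammWerner2004SAW, KemppainenSmirnov2017, route-CriticalPhenomena-SAWParafermion]
#9 EventualTight (support) — shared item stmt-CriticalPhenomena-1881 (verbatim signature, route
SAWLeftRightFKG): eventual tightness IsTightAlongMesh of the pushed-forward critical SAW laws for
every Dobrushin domain and endpoint approximation — the repaired form of the refuted all-δ Tight
(stmt-0772); this route adds no mechanism for it (Condition G2 would give it too). [difficulty:
open-problem] [KemppainenSmirnov2017,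
Summit.CriticalPhenomena.SAWScalingLimit.Theorems.SAWParafermionTight_refuted,
route-CriticalPhenomena-SAWLeftRightFKG]

TWO-LAYER PLAN. Foreseen glued splits (none filed now): SchrammIdentifies ⇐ KSDataSAW (a.e.
Loewner-describability of subsequential limits + convergence in law of the
capacity driving processes of boundary-completed SAW polylines; from Condition G2, cf.
SAWParafermion.KSConditionG2 stmt-0791) → PassageToCylinder
(SPU + KS data ⇒ the Schramm cylinder identity for (ν, drivingFunction φ), via the exact discrete
martingale in slit CELL domains and the joint
continuity of (u, W) ↦ S_{u∧Im²/9}(z)(W)) → SchrammIdentifies [glue = SchrammCharacterisesSLE].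
ClosureToSchramm ⇐ SchrodingerStability → ArcBoundaryValues → SideFieldEquicontinuity — FILED
2026-08-17 as route items (stmt-19046 / 17592 / 17593) with the glue item ClosureToSchrammOfPieces
(stmt-17594, proof done in Cruxes/ClosureToSchramm/SplitGlueByName.lean); `closes` consumes the
three pieces (rev 4). The formal parent→children edge (`route edit --split ClosureToSchramm --into …
--glue-by <landed closureToSchrammOfPieces>`) is left to the tenure/final-cycle seat once a prover
lands the glue (the split verb is final-cycle-only for strategist seats). TurningClosure ⇐
LocalResponse (mean turning of the bi-infinite SAW in a weak harmonic
'side field' = (π²/2)×energy×side, Kesten's measure) → Mesoscopic averaging → TurningClosure.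

KILL CRITERIA. ¬SchrammPassage (pointwise, any Jordan domain — e.g. certified
enumeration/Monte-Carlo extrapolation contradicting cos²(θ/2) in a strip or
rectangle) refutes SchrammPassageUniform and TurningClosure's mechanism at once: close
refuted:SchrammPassageUniform (and it would be major evidence
against SLE_{8/3} itself, since the formula is a theorem about SLE_{8/3}). ¬TurningClosure alone
(weak identity fails while the side law converges)
is impossible — so a refutation of TurningClosure is a refutation of the side law: close.
¬SchrammPassageUniform with SchrammPassage standing
(uniformity fails only in degenerate cell domains) ⇒ pivot: restate SPU with a Carathéodory inradius
condition along the whole domain, keep the line.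
SubseqIdentification or EventualTight refuted (shared items) breaks every KS-type SAW route
including this one. SubseqIdentification proved elsewhere
(parafermion, restriction rigidity) moots cruxes 2–5 but not the route's assembly.

NOT DECOMPOSED YET. Kemppainen–Smirnov data for the SAW (Condition G2 ⇒ describability + driver
convergence; boundary completion for interior starting points), the
cylinder passage and the far-field bookkeeping (children of SchrammIdentifies); (the children of
ClosureToSchramm ARE filed, see RANKED CRUXES #4a–c; below them only birth-skeleton stubs, no third
layer); the card's density law (L2: δ^{-2/3}ρ_δ → c|J_exc|^{2/3}, the SAW analogue of the
Beneš–Lawler–Viklund LERW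
Green's function) and current law (L1 proper) — consequences/strengthenings not needed by the
assembly; the glue SchrammPassageUniform → SchrammPassage
(Carathéodory kernel convergence of cell domains, boundary correspondence Pommerenke1992).

CHEAPEST FALSIFIER. Exact enumeration (transfer matrix) of x_c-weighted SAWs in lattice
strips/rectangles up to ≈ 9 × 30 with mid-side endpoints, or Kennedy-style pivot
Monte Carlo in the half-plane/strip (Kennedy2002 already matched the INTEGRATED left-passage law to
≈ 0.5 % with the conformal map inserted by
hand): (a) tabulate h_δ(z) against (1 − cos πω_δ(z))/2 with ω_δ the DISCRETE harmonic measure of the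
left arc (map-free test of SchrammPassage);
(b) tabulate τ_δ(f)/(|∇_δω_δ|²(f)(2h_δ(f) − 1)) over interior faces — it must flatten to π²/2 ≈ 4.93
away from a, b as sizes grow (test of
TurningClosure as a mechanism, sharper than (a)). Not run here (kit not in this unit's payload);
μ(ℤ²) ∈ [2.6, 2.7] is in the tree
(SAW.LawlerSchrammWerner2004SAW_connectiveConstant_bounds as hypothesis; certified bounds in
SelfAvoidingWalkCert) so x_c-weights are interval-decidable.

NUMBERS. κ = 8/3: Schramm's left-passage law P = ½ + Γ(4/κ)cot(θ)₂F₁(½, 4/κ; 3/2; −cot²θ)/(√π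
Γ((8−κ)/(2κ))) collapses to cos²(θ/2) (Schramm2001Percolation
Thm 2); closure constant π²/2 ≈ 4.9348; far-field coefficients: E[W_t] = 0 at order R⁻¹, E[4t −
(3/2)W_t²] const at order R⁻² ⇒ ⟨W⟩_t = (8/3)t;
third order on the imaginary axis: −2∫₀ᵗW ds + W_t³/2 − 2tW_t martingale iff κ = 8/3 ((3κ/2 − 4) t
W_t drift); linear closure iff κ ∈ {8/3, 4}
(F″ = −π²(F − ½) vs F″ = 0); zero mode: sup_θ(−cos θ + B sin θ) = √(1+B²). Items at open: 9 (4
cruxes, 4 support, 1 assembly).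

DEFINITION REQUESTS. Two notions would shorten every signature here and in sibling routes (filed
after open with `ledger workitem add --kind definition`):
(1) CellDomain S δ — the interior of the union of the octagonal δ-cells around a finite S ⊂ ℤ²
(faithful: mesh vertices = S, induced edges; Jordan
when simply connected; stable under SAW slitting), topic Literature/Probability/LatticeModels; (2)
SAW.sideProbability — the side/left-passage field
h_δ(z) of a lattice chord (winding of polyline + boundary arc ≠ 0), topic
Literature/Probability/RandomPlanarGeometry. No cite facts requested:
Schramm's martingale (martingale_schrammObsStopped_sle), the κ < 4 identification
(isSLELaw_of_isLocalMartingale_driving_of_lt_four), chordal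
uniformizers (MarkedDomain.exists_isChordalUniformizing_holds) and the convergence criterion are
PROVED in the tree.
DEGENERATE CASES CHECKED. (i) Orientation: with D.boundary counter-clockwise (D.index z = +1) arc 0
= Φ((0,∞)) is the right bank and the loop 'polyline + [q,pt 1] + arc 1 + [pt 0,p]' encloses the LEFT
side, limit (1 − cos θ)/2 = sin²(θ/2); clockwise parametrisation flips both, whence the factor
D.index z. (ii) p = q with distinct exterior neighbours: the only SAW is nil, the loop is two cell
radii + arc 1, P ∈ {0,1} and Schramm's value seen from z (≥ Nδ away) is within O(1/N) of the same
0/1 (the short arc has vanishing harmonic measure) — consistent. (iii) Scale: every hypothesis of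
SchrammPassageUniform / TurningClosure is invariant under (S, δ, D, Φ, z) ↦ scaled copies, so '∀ δ >
0' carries no all-δ trap of the stmt-0772 kind. (iv) Zero mode: bounded solutions of (Δ + |∇θ|²)u =
0 in ℍ with u(·,0) = −1, u(·,π) = 1 are −cos θ + B sin θ (modes m ≥ 2 grow like r^{±√(m²−1)}); |u| ≤
1 forces B = 0 since sup(−cos θ + B sin θ) = √(1+B²). (v) Far field: at z = iy the R⁻² coefficient
of cos arg(z_t) vanishes (factor cos φ), so SchrammCharacterisesSLE must use off-axis points (φ =
π/4: 4t − (3/2)W² at order R⁻²) or the third-order term; checked by hand. (vi) z on a lattice line: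
the polyline may pass through z (wind junk 0) only on the event that γ uses the edge through z, of
probability → 0 with the room N (one-point density), absorbed in ε.

Novelty: Searches (2026-08-15): `lit search "left passage probability self-avoiding walk SLE 8/3 Schramm
formula lattice"` and `--source arxiv` (searchd
connection reset / arXiv HTTP 429 — 0 rows, service down, noted in NOTES.md); `lit galaxy search
"left-passage probability" --star all` (5 pdf hits:
arXiv:2409.03235 SLE₆/percolation parafermion, Duminil-Copin–Manolescu–Tassion RCM fractal
properties, Henkel–Karevski lecture notes — none on SAW);
`lit galaxy search "self-avoiding walk" --star all` (25 rows, books/polymer physics, nothing on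
passage laws); `lit galaxy search "Schramm's formula"
--star pdf`; `lit frontier CriticalPhenomena --since 2020` (30 descendants: sub-ballisticity
arXiv:2310.17299, SLE regularity arXiv:2211.15609, pairing
probabilities arXiv:2208.06008 — none uses a side-probability observable for SAW); references.bib
keys checked (Schramm2001Percolation, Kennedy2002,
Kennedy2004, SchrammSheffield2005, KennedyLawler2013); all six sibling route files and the 138-card
idea list of the sub-problem read (cards
armchair-observer-malus-law, schramm-kirchhoff-current, current-geometric-mean-schramm are earlier
filings of the same observable, merged into the spine
card; tilted-harmonic-explorer / turn-defect-kernel-orthogonality use harmonic DATA martingales of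
imaginary-geometry type, not the side probability).
Nearest prior art found: Schramm2001Percolation (the formula, SLE side), Kennedy2002 / Kennedy2004
(arXiv:math/0112246, math/0207231: Monte-Carlo
confirmation for  [refs: 2409.03235, 2310.17299, 2211.15609, 2208.06008, math/0112246, math/0310210, Kennedy2002, Kennedy2004, SchrammSheffield2005, KennedyLawler2013, CDHKSCRAS2014, KemppainenSmirnov2017]

Barriers (technique_class: martingale-observable left-passage turning-closure): - technique_class: martingale-observable left-passage turning-closure
- Literature.Barriers.CriticalPhenomena.NienhuisWeightsExcludeVertexSAW: respected, not contradicted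
— no exact local relation is claimed for the ℤ² SAW; the only exact identity used (Δ_δh_δ =
−E[turning]) is topological and model-independent, and TurningClosure is asymptotic, after
mesoscopic averaging against C² test functions.
- Literature.Barriers.CriticalPhenomena.ParafermionicHalfCauchyRiemann: outside the class — no
discrete holomorphicity / Riemann–Hilbert problem; the limit object solves a real, positive
Dirichlet problem for Δ + π²|∇ω|² with uniqueness by separation of variables plus 0 ≤ h ≤ 1.
- Literature.Barriers.CriticalPhenomena.EmbeddingModulusUniqueness: evaded in the only way possible
— the limit VALUE is embedding-sensitive through the chordal uniformizer Φ of the cell domain (arg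
Φ⁻¹, |∇ arg Φ⁻¹|²), i.e. the statements are calibrated against the isotropic Laplacian of ℤ²; on a
sheared embedding the same items would (correctly) predict the sheared SLE. The bet is that the
turning closure is where isotropy is actually proved.
- Literature.Barriers.CriticalPhenomena.SAWNotKineticallyGrown: no growth rule is posited; the
martingale is the tower property of the fixed chordal x_c-measure under its exact domain Markov
property.
- Literature.Barriers.CriticalPhenomena.SAWNoUnitaryCFT: no reflection positivity, Virasoro
structure or c = 0 CFT input; κ = 8/3 enters only through Schramm's ODE coeff

History (route lifecycle, newest last):
- 2026-08-15T11:52:34Z · rev 1: restated SchrammIdentifies (stmt-CriticalPhenomena-5598) — materialise SchrammIdentifies: conclusion = SubseqIdentification (stmt-0783) inlined verbatim (Iff.rfl with the support decl), because the gate renders cruxes b (planner-plancard-CriticalPhenomena-SAWScaling-13f7a480-0)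
- 2026-08-15T16:53:41Z · rev 1: restated TurningClosure (stmt-CriticalPhenomena-5595), SchrammPassageUniform (stmt-CriticalPhenomena-5596), Assembly (stmt-CriticalPhenomena-5601) — route-repair (rbadge g2): (i) vacuity block of refuter d52f2078 — restate TurningClosure + SchrammPassageUniform with the repaired cell shape (octagons ∪ filler (planner-rbadge-CriticalPhenomena-SAWSchrammPas-4cc272f4-g2-0)
- 2026-08-26T04:21:58Z · DORMANT — reconciler: no traction for 8.3 d (last activity item-evidence-added at 2026-08-17T19:24:59Z); parked, not closed — `ledger route dormant route-CriticalPhenomen (operator:999:2293207)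

sub-problem: SAWScalingLimit · status: dormant · opened planner-plancard-CriticalPhenomena-SAWScaling-13f7a480-0 2026-08-15T11:41:45Z · rev 5 · ledger route-CriticalPhenomena-SAWSchrammPassage
GENERATED by the gate from the ledger (D-0016/17). Provers cite these decls: `theorem foo : Summit.CriticalPhenomena.SAWScalingLimit.Theses.SAWSchrammPassage.<Decl> := …` in Summits/CriticalPhenomena/SAWScalingLimit/Theorems/<Name>.lean.
-/

namespace Summit.CriticalPhenomena.SAWScalingLimit.Theses.SAWSchrammPassage

open scoped BigOperators Topology Manifold Classical MeasureTheory ProbabilityTheory Matrix InnerProductSpace ComplexConjugate ContinuousMap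
open Filter Set Function TopologicalSpace MeasureTheory

attribute [summit_statement] _root_.SAWScalingLimit

-- earlier TurningClosure (stmt-CriticalPhenomena-5595, replaced 2026-08-15T16:53:41Z -> stmt-CriticalPhenomena-11226): retired by None — ∀ (ψ : ℂ → ℝ), ContDiff ℝ 2 ψ → HasCompactSupport ψ → ∀ ε > (0 : ℝ), ∀ r > (0 : ℝ), ∃ δ₀ > (0 : ℝ), ∀ (δ : ℝ) (S : Finset (Literature.Probability.LatticeModels.Site 2)) (p p' q q' : Literature.Probability.LatticeModels.Site 2) (D : Literature.Probability.RandomPlan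
/-- item stmt-CriticalPhenomena-11226 · crux · rank 2 · open · by planner
why it might fail: Necessary for Schramm's formula (false iff the SAW side law is not the κ=8/3 one); as a MECHANISM it needs a local linear-response law 'mean turning = (π²/2)|∇ω|²(2h−1)' with NO lattice correction factor — a KennedyLawler2013-type lattice constant ≠ 1 in the bulk breaks the closure.
sources: Schramm2001Percolation, Kennedy2002, KennedyLawler2013, SchrammSheffield2005, Summits/CriticalPhenomena/SAWScalingLimit/Ideas/excursion-current-laws.md
[crux] card item TurningClosure in weak form, REPAIRED CELL SHAPE (rev 3; refuter d52f2078: the bare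
octagon union had a diamond hole at every face centre, making the item vacuous): for ψ ∈ C²_c and
every cell domain D — carrier = interior of the union of the δ-octagons |x|,|y| ≤ δ/2, |x|+|y| ≤
9δ/10 around the sites of S TOGETHER WITH the filler diamonds |x−c|+|y−c'| ≤ δ/10 at the centres
(c,c') of the faces whose four corner sites lie in S (so 2×2 blocks are solid, diagonal-only
contacts stay separated: no holes, no corner pinches, SAW-slit domains stay in the class), marks at
the side midpoints towards exterior neighbours p', q' of p, q ∈ S, Φ any chordal uniformizer —
containing the r-neighbourhood of supp ψ, the face sums Σ_f H_f Δ_δΨ_f + ½ Ψ_f E_f (2H_f − 1) are ≤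
ε for 0 < δ ≤ δ₀(ψ, ε, r), where H_f = side probability of the face centre (winding of SAW polyline
+ [q,b] + arc 1 + [a,p] about it ≠ 0), Ψ_f = ψ(centre), E_f = π²|∇_δ(arg Φ⁻¹/π)|²(f); side-symmetric
(h ↦ 1 − h leaves it invariant). [deps: none] [difficulty: open-problem] -/
@[route_item "route-CriticalPhenomena-SAWSchrammPassage", crux]
def TurningClosure : Prop :=
  ∀ (ψ : ℂ → ℝ), ContDiff ℝ 2 ψ → HasCompactSupport ψ → ∀ ε > (0 : ℝ), ∀ r > (0 : ℝ), ∃ δ₀ > (0 : ℝ), ∀ (δ : ℝ) (S : Finset (Literature.Probability.LatticeModels.Site 2)) (p p' q q' : Literature.Probability.LatticeModels.Site 2) (D : Literature.Probability.RandomPlanarGeometry.DobrushinDomain) (Φ : Literature.Probability.RandomPlanarGeometry.ConformalEquiv UpperHalfPlane.upperHalfPlaneSet D.carrier), let c : Literature.Probability.LatticeModels.Site 2 → ℂ := fun f => Literature.Probability.LatticeModels.meshPoint δ f + ((δ / 2 : ℝ) : ℂ) * (1 + Complex.I); let L : Literature.Probability.RandomPlanarGeometry.SAW.DomainSAW D.carrier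 δ p q → ℝ → ℂ := fun γ t => if t ≤ 1 / 2 then (γ.walk.toCurve (Literature.Probability.LatticeModels.meshPoint δ)) (Set.projIcc (0 : ℝ) 1 zero_le_one (2 * t)) else if 2 * t - 1 ≤ 1 / 3 then Literature.Probability.LatticeModels.meshPoint δ q + ((3 * (2 * t - 1) : ℝ) : ℂ) * (D.pt 1 - Literature.Probability.LatticeModels.meshPoint δ q) else if 2 * t - 1 ≤ 2 / 3 then D.boundary (D.mark 1 + (3 * (2 * t - 1) - 1) * (D.mark 0 + 1 - D.mark 1)) else D.pt 0 + ((3 * (2 * t - 1) - 2 : ℝ) : ℂ) * (Literature.Probability.LatticeModels.meshPoint δ p - D.pt 0); let H : Literature.Probability.LatticeModels.Site 2 → ℝ := fun f => (Literature.Probability.RandomPlanarGeometry.SAW.law D.carrier δ p q {γ | Literature.Topology.PlaneTopology.wind (fun t => L γ t - c f) ≠ 0}).toReal; let Ψ : Literature.Probability.LatticeModels.Site 2 → ℝ := fun f => ψ (c f); let ω : ℂ → ℝ := fun w => Complex.arg (Φ.symm w) / Real.pi; let E : Literature.Probability.LatticeModels.Site 2 → ℝ := fun f => Real.pi ^ 2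 * ((ω (c (f + ![1, 0])) - ω (c f)) ^ 2 + (ω (c (f + ![0, 1])) - ω (c f)) ^ 2); δ ∈ Set.Ioc 0 δ₀ → p ∈ S → q ∈ S → p' ∉ S → q' ∉ S → (Literature.Probability.LatticeModels.zdGraph 2).Adj p p' → (Literature.Probability.LatticeModels.zdGraph 2).Adj q q' → D.carrier = interior ({w : ℂ | ∃ v ∈ S, |w.re - (Literature.Probability.LatticeModels.meshPoint δ v).re| ≤ δ / 2 ∧ |w.im - (Literature.Probability.LatticeModels.meshPoint δ v).im| ≤ δ / 2 ∧ |w.re - (Literature.Probability.LatticeModels.meshPoint δ v).re| + |w.im - (Literature.Probability.LatticeModels.meshPoint δ v).im| ≤ 9 * δ / 10} ∪ {w : ℂ | ∃ v ∈ S, v + ![1, 0] ∈ S ∧ v + ![0, 1] ∈ S ∧ v + ![1, 1] ∈ S ∧ |w.re - (Literature.Probability.LatticeModels.meshPoint δ v).re - δ / 2| + |w.im - (Literature.Probability.LatticeModels.meshPoint δ v).im - δ / 2| ≤ δ / 10}) → D.pt 0 = (Literature.Probability.LatticeModels.meshPoint δ p + Literature.Probability.LatticeModels.meshPoint δ p')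 / 2 → D.pt 1 = (Literature.Probability.LatticeModels.meshPoint δ q + Literature.Probability.LatticeModels.meshPoint δ q') / 2 → D.IsChordalUniformizing Φ → Metric.cthickening r (tsupport ψ) ⊆ D.carrier → |∑' f : Literature.Probability.LatticeModels.Site 2, (H f * Literature.Probability.LatticeModels.latticeLaplacian Ψ f + (1 / 2) * Ψ f * E f * (2 * H f - 1))| ≤ ε

-- earlier SchrammPassageUniform (stmt-CriticalPhenomena-5596, replaced 2026-08-15T16:53:41Z -> stmt-CriticalPhenomena-11227): retired by None — ∀ ε > (0 : ℝ), ∃ N : ℕ, ∀ (δ : ℝ) (S : Finset (Literature.Probability.LatticeModels.Site 2)) (p p' q q' : Literature.Probability.LatticeModels.Site 2) (D : Literature.Probability.RandomPlanarGeometry.DobrushinDomain) (Φ : Literature.Probability.RandomPlanarG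
/-- item stmt-CriticalPhenomena-11227 · crux · rank 3 · open · by planner
why it might fail: It is conformal invariance of the SAW one-point side law (open even on the hexagonal lattice); uniformity asks N(ε) cells of room at z ONLY — a domain whose bottlenecks/fjords at lattice scale bias the walk macroscopically, or interior-vs-boundary start effects, would break the uniform form first.
sources: Schramm2001Percolation, Kennedy2002, Kennedy2004, LawlerSchrammWerner2004SAW, KemppainenSmirnov2017, Beffara2008
[crux] Schramm's κ = 8/3 formula for the critical ℤ² SAW, uniformly over cell domains, REPAIRED CELL
SHAPE (rev 3; refuter d52f2078: with bare octagons no point had δ of room, the item was vacuous):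
for every ε there is N such that for every mesh δ > 0, finite S ⊂ ℤ², boundary-adjacent p, q ∈ S
with exterior neighbours p', q', Jordan D whose carrier is the cell domain of S (interior of the
union of the δ-octagons |x|,|y| ≤ δ/2, |x|+|y| ≤ 9δ/10 around S and of the filler diamonds of
ℓ¹-radius δ/10 at the centres of faces whose four corners lie in S) with marks at the two side
midpoints, chordal uniformizer Φ (0 ↦ pt 0, ∞ ↦ pt 1) and z ∈ D with N δ ≤ dist(z, ∂D), ‖Φ⁻¹z‖ = 1:
|P_δ[wind(loop_γ, z) ≠ 0] − (1 − index_D(z)·Re Φ⁻¹(z))/2| ≤ ε (index = ±1 fixes which bank arc 1 is;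
cos arg = Re at modulus 1). [difficulty: open-problem] -/
@[route_item "route-CriticalPhenomena-SAWSchrammPassage"]
def SchrammPassageUniform : Prop :=
  ∀ ε > (0 : ℝ), ∃ N : ℕ, ∀ (δ : ℝ) (S : Finset (Literature.Probability.LatticeModels.Site 2)) (p p' q q' : Literature.Probability.LatticeModels.Site 2) (D : Literature.Probability.RandomPlanarGeometry.DobrushinDomain) (Φ : Literature.Probability.RandomPlanarGeometry.ConformalEquiv UpperHalfPlane.upperHalfPlaneSet D.carrier) (z : ℂ), let L : Literature.Probability.RandomPlanarGeometry.SAW.DomainSAW D.carrier δ p q → ℝ → ℂ := fun γ t => if t ≤ 1 / 2 then (γ.walk.toCurve (Literature.Probability.LatticeModels.meshPoint δ)) (Set.projIcc (0 : ℝ) 1 zero_le_one (2 * t)) else if 2 * t - 1 ≤ 1 / 3 then Literature.Probability.LatticeModels.meshPoint δ q + ((3 * (2 * t - 1) : ℝ) : ℂ) * (D.pt 1 - Literature.Probability.LatticeModels.meshPoint δ q) else if 2 * t - 1 ≤ 2 / 3 then D.boundary (D.mark 1 + (3 * (2 * t - 1) - 1) * (D.mark 0 + 1 - D.mark 1)) else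 D.pt 0 + ((3 * (2 * t - 1) - 2 : ℝ) : ℂ) * (Literature.Probability.LatticeModels.meshPoint δ p - D.pt 0); 0 < δ → p ∈ S → q ∈ S → p' ∉ S → q' ∉ S → (Literature.Probability.LatticeModels.zdGraph 2).Adj p p' → (Literature.Probability.LatticeModels.zdGraph 2).Adj q q' → D.carrier = interior ({w : ℂ | ∃ v ∈ S, |w.re - (Literature.Probability.LatticeModels.meshPoint δ v).re| ≤ δ / 2 ∧ |w.im - (Literature.Probability.LatticeModels.meshPoint δ v).im| ≤ δ / 2 ∧ |w.re - (Literature.Probability.LatticeModels.meshPoint δ v).re| + |w.im - (Literature.Probability.LatticeModels.meshPoint δ v).im| ≤ 9 * δ / 10} ∪ {w : ℂ | ∃ v ∈ S, v + ![1, 0] ∈ S ∧ v + ![0, 1] ∈ S ∧ v + ![1, 1] ∈ S ∧ |w.re - (Literature.Probability.LatticeModels.meshPoint δ v).re - δ / 2| + |w.im - (Literature.Probability.LatticeModels.meshPoint δ v).im - δ / 2| ≤ δ / 10}) → D.pt 0 = (Literature.Probability.LatticeModels.meshPoint δ p + Literature.Probability.LatticeModels.meshPoint δ p') / 2 → D.pt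 1 = (Literature.Probability.LatticeModels.meshPoint δ q + Literature.Probability.LatticeModels.meshPoint δ q') / 2 → D.IsChordalUniformizing Φ → z ∈ D.carrier → (N : ℝ) * δ ≤ Metric.infDist z D.carrierᶜ → ‖Φ.symm z‖ = 1 → |(Literature.Probability.RandomPlanarGeometry.SAW.law D.carrier δ p q {γ | Literature.Topology.PlaneTopology.wind (fun t => L γ t - z) ≠ 0}).toReal - (1 - (D.index z : ℝ) * (Φ.symm z).re) / 2| ≤ ε

/-- item stmt-CriticalPhenomena-17593 · crux · rank 4 · open · by planner
why it might fail: No one-arm / one-point decay is proved for the critical SAW law in a domain; uniformity over all cell domains and endpoints is the risk — a geometry steering the walk through B(x, ρ·dist) (the annulus around it is free, but x_c-weights must not favour the visit).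
sources: LawlerSchrammWerner2004SAW, LawlerSchrammWerner2002OneArm, DuminilCopinHammond2013, MadrasSlade1993, KemppainenSmirnov2017
[crux] Macroscopic equicontinuity of the SAW side field, UNIFORMLY over cell configurations and
scale-free (child 3/3 of the strategist's split of ClosureToSchramm): for every e > 0 there are ρ >
0 and N such that for every cell configuration (δ, S, p, p', q, q', D, Φ) and all points x, x' with
x ∈ D, N δ ≤ dist(x, ∂D) and ‖x' − x‖ ≤ ρ·dist(x, ∂D), |P_δ[wind(loop_γ, x) ≠ 0] − P_δ[wind(loop_γ,
x') ≠ 0]| ≤ e. Since the two winding numbers differ only if the SAW polyline meets the segment [x,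
x'], this is the one-arm-type bound P_δ[γ visits B(x, ρ·dist(x,∂D))] → 0 as ρ → 0 uniformly (for
SLE_{8/3} the exponent is ρ^{2/3}); stated pointwise it also forbids a positive density of the walk
on any fixed edge deep inside. A consequence of SchrammPassageUniform plus the Koebe gradient bound
|∇ arg Φ⁻¹| ≤ C/dist(·,∂D); feeds hypothesis (ii) of SchrodingerStability. The binder Φ (with
IsChordalUniformizing) is the shared cell-configuration frame of SchrammPassageUniform and is
dischargeable by MarkedDomain.exists_isChordalUniformizing_holds (the conclusion is Φ-free). BC2
probes → SAWScalingLimit / → ClosureToSchramm fail. [difficulty: open-problem] -/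
@[route_item "route-CriticalPhenomena-SAWSchrammPassage", crux]
def SideFieldEquicontinuity : Prop :=
  ∀ e > (0 : ℝ), ∃ ρ > (0 : ℝ), ∃ N : ℕ, ∀ (δ : ℝ) (S : Finset (Literature.Probability.LatticeModels.Site 2)) (p p' q q' : Literature.Probability.LatticeModels.Site 2) (D : Literature.Probability.RandomPlanarGeometry.DobrushinDomain) (Φ : Literature.Probability.RandomPlanarGeometry.ConformalEquiv UpperHalfPlane.upperHalfPlaneSet D.carrier) (x x' : ℂ), let L : Literature.Probability.RandomPlanarGeometry.SAW.DomainSAW D.carrier δ p q → ℝ → ℂ := fun γ t => if t ≤ 1 / 2 then (γ.walk.toCurve (Literature.Probability.LatticeModels.meshPoint δ)) (Set.projIcc (0 : ℝ) 1 zero_le_one (2 * t)) else if 2 * t - 1 ≤ 1 / 3 then Literature.Probability.LatticeModels.meshPoint δ q + ((3 * (2 * t - 1) : ℝ) : ℂ) * (D.pt 1 - Literature.Probability.LatticeModels.meshPoint δ q) else if 2 * t - 1 ≤ 2 / 3 then D.boundary (D.mark 1 + (3 * (2 * t - 1) - 1) * (D.mark 0 + 1 - D.mark 1)) else D.pt 0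 + ((3 * (2 * t - 1) - 2 : ℝ) : ℂ) * (Literature.Probability.LatticeModels.meshPoint δ p - D.pt 0); 0 < δ → p ∈ S → q ∈ S → p' ∉ S → q' ∉ S → (Literature.Probability.LatticeModels.zdGraph 2).Adj p p' → (Literature.Probability.LatticeModels.zdGraph 2).Adj q q' → D.carrier = interior ({w : ℂ | ∃ v ∈ S, |w.re - (Literature.Probability.LatticeModels.meshPoint δ v).re| ≤ δ / 2 ∧ |w.im - (Literature.Probability.LatticeModels.meshPoint δ v).im| ≤ δ / 2 ∧ |w.re - (Literature.Probability.LatticeModels.meshPoint δ v).re| + |w.im - (Literature.Probability.LatticeModels.meshPoint δ v).im| ≤ 9 * δ / 10} ∪ {w : ℂ | ∃ v ∈ S, v + ![1, 0] ∈ S ∧ v + ![0, 1] ∈ S ∧ v + ![1, 1] ∈ S ∧ |w.re - (Literature.Probability.LatticeModels.meshPoint δ v).re - δ / 2| + |w.im - (Literature.Probability.LatticeModels.meshPoint δ v).im - δ / 2| ≤ δ / 10}) → D.pt 0 = (Literature.Probability.LatticeModels.meshPoint δ p + Literature.Probability.LatticeModels.meshPoint δ p') / 2 → D.pt 1 = (Literature.Probability.LatticeModels.meshPoint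 δ q + Literature.Probability.LatticeModels.meshPoint δ q') / 2 → D.IsChordalUniformizing Φ → x ∈ D.carrier → (N : ℝ) * δ ≤ Metric.infDist x D.carrierᶜ → ‖x' - x‖ ≤ ρ * Metric.infDist x D.carrierᶜ → |(Literature.Probability.RandomPlanarGeometry.SAW.law D.carrier δ p q {γ | Literature.Topology.PlaneTopology.wind (fun t => L γ t - x) ≠ 0}).toReal - (Literature.Probability.RandomPlanarGeometry.SAW.law D.carrier δ p q {γ | Literature.Topology.PlaneTopology.wind (fun t => L γ t - x') ≠ 0}).toReal| ≤ e

/-- item stmt-CriticalPhenomena-5597 · crux · rank 4 · open · by planner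
why it might fail: Needs two a-priori SAW inputs not in print: boundary values (the walk separates z from a nearby arc with small probability — a Beurling-type estimate at x_c) and equicontinuity of h_δ (P[γ through a mesoscopic ball] → 0, a one-arm bound); without them weak solutions need not be the pointwise limit.
sources: Schramm2001Percolation, DuminilCopinHammond2013, MadrasSlade1993, Lawler2005
[crux] the weak turning closure implies the uniform Schramm passage: weak-* limits of h_δ along any
sequence of cell domains (Carathéodory-normalised at z) solve (Δ + π²|∇ω|²)(2h − 1) = 0 in D'(Ω);
boundary values h → 1/0 at the two arcs (a SAW boundary-proximity estimate) and 0 ≤ h ≤ 1 force,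
after transport to ℍ and separation of variables (modes sin mθ · r^{±√(m²−1)} unbounded for m ≥ 2,
zero mode B sin θ excluded by √(1+B²) ≤ 1), h = (1 − cos θ)/2; equicontinuity of h_δ in z upgrades
weak to uniform convergence. [deps: TurningClosure, SchrammPassageUniform] [difficulty: L] -/
@[route_item "route-CriticalPhenomena-SAWSchrammPassage"]
def ClosureToSchramm : Prop :=
  TurningClosure → SchrammPassageUniform

/-- item stmt-CriticalPhenomena-17592 · crux · rank 5 · open · by planner
why it might fail: No Beurling-type estimate is known for the x_c-weighted SAW in a domain; uniformity over ALL cell domains is the risk: lattice-width fjords at the adjacent arc, or p, q conformally close to x, might keep the wrong-side probability bounded below despite N cells of room.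
sources: LawlerSchrammWerner2004SAW, DuminilCopinHammond2013, MadrasSlade1993, Kesten1987, Schramm2001Percolation
[crux] Boundary values of the SAW side field near the two arcs, UNIFORMLY over cell configurations
(child 2/3 of the strategist's split of ClosureToSchramm): for every e > 0 there are η > 0 and N
such that for every cell configuration (δ, S, p, p', q, q', D, Φ) (same frame as
SchrammPassageUniform) and every x ∈ D with N δ ≤ dist(x, ∂D) and arg Φ⁻¹(x) ≤ η or ≥ π − η (x
conformally adjacent to one boundary arc), |P_δ[wind(loop_γ, x) ≠ 0] − (1 − index_D(x)·cos arg
Φ⁻¹(x))/2| ≤ e — i.e. the critical SAW from p to q squeezes between x and the adjacent arc only with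
small probability (a Beurling-type boundary-proximity estimate at x_c). A consequence of
SchrammPassageUniform itself; feeds hypothesis (i) of SchrodingerStability for the normalised
configuration. BC2 probes → SAWScalingLimit / → ClosureToSchramm fail. [difficulty: open-problem] -/
@[route_item "route-CriticalPhenomena-SAWSchrammPassage", crux]
def ArcBoundaryValues : Prop :=
  ∀ e > (0 : ℝ), ∃ η > (0 : ℝ), ∃ N : ℕ, ∀ (δ : ℝ) (S : Finset (Literature.Probability.LatticeModels.Site 2)) (p p' q q' : Literature.Probability.LatticeModels.Site 2) (D : Literature.Probability.RandomPlanarGeometry.DobrushinDomain) (Φ : Literature.Probability.RandomPlanarGeometry.ConformalEquiv UpperHalfPlane.upperHalfPlaneSet D.carrier) (x : ℂ), let L : Literature.Probability.RandomPlanarGeometry.SAW.DomainSAW D.carrier δ p q → ℝ → ℂ := fun γ t => if t ≤ 1 / 2 then (γ.walk.toCurve (Literature.Probability.LatticeModels.meshPoint δ)) (Set.projIcc (0 : ℝ) 1 zero_le_one (2 * t)) else if 2 * t - 1 ≤ 1 / 3 then Literature.Probability.LatticeModels.meshPoint δ q + ((3 * (2 * t - 1) : ℝ) : ℂ) * (D.pt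 1 - Literature.Probability.LatticeModels.meshPoint δ q) else if 2 * t - 1 ≤ 2 / 3 then D.boundary (D.mark 1 + (3 * (2 * t - 1) - 1) * (D.mark 0 + 1 - D.mark 1)) else D.pt 0 + ((3 * (2 * t - 1) - 2 : ℝ) : ℂ) * (Literature.Probability.LatticeModels.meshPoint δ p - D.pt 0); 0 < δ → p ∈ S → q ∈ S → p' ∉ S → q' ∉ S → (Literature.Probability.LatticeModels.zdGraph 2).Adj p p' → (Literature.Probability.LatticeModels.zdGraph 2).Adj q q' → D.carrier = interior ({w : ℂ | ∃ v ∈ S, |w.re - (Literature.Probability.LatticeModels.meshPoint δ v).re| ≤ δ / 2 ∧ |w.im - (Literature.Probability.LatticeModels.meshPoint δ v).im| ≤ δ / 2 ∧ |w.re - (Literature.Probability.LatticeModels.meshPoint δ v).re| + |w.im - (Literature.Probability.LatticeModels.meshPoint δ v).im| ≤ 9 * δ / 10} ∪ {w : ℂ | ∃ v ∈ S, v + ![1, 0] ∈ S ∧ v + ![0, 1] ∈ S ∧ v + ![1, 1] ∈ S ∧ |w.re - (Literature.Probability.LatticeModels.meshPoint δ v).re - δ / 2| + |w.im - (Literature.Probability.LatticeModels.meshPoint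 δ v).im - δ / 2| ≤ δ / 10}) → D.pt 0 = (Literature.Probability.LatticeModels.meshPoint δ p + Literature.Probability.LatticeModels.meshPoint δ p') / 2 → D.pt 1 = (Literature.Probability.LatticeModels.meshPoint δ q + Literature.Probability.LatticeModels.meshPoint δ q') / 2 → D.IsChordalUniformizing Φ → x ∈ D.carrier → (N : ℝ) * δ ≤ Metric.infDist x D.carrierᶜ → (Complex.arg (Φ.symm x) ≤ η ∨ Real.pi - η ≤ Complex.arg (Φ.symm x)) → |(Literature.Probability.RandomPlanarGeometry.SAW.law D.carrier δ p q {γ | Literature.Topology.PlaneTopology.wind (fun t => L γ t - x) ≠ 0}).toReal - (1 - (D.index x : ℝ) * ((Φ.symm x).re / ‖Φ.symm x‖)) / 2| ≤ e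

-- earlier SchrammIdentifies (stmt-CriticalPhenomena-5598, replaced 2026-08-15T11:52:34Z -> stmt-CriticalPhenomena-6792): retired by None — SchrammPassageUniform → SubseqIdentification
/-- item stmt-CriticalPhenomena-6792 · crux · rank 5 · open · by planner
why it might fail: Step (i) is Kemppainen–Smirnov Condition G2 for the critical SAW — no FKG/RSW, open (KS17 §4 covers FK, percolation, HE, LERW only); interior starting points allowed by IsEndpointApprox need a completion-to-the-boundary argument before any Loewner description exists.
sources: KemppainenSmirnov2017, CDHKSCRAS2014, SchrammSheffield2005, Schramm2001Percolation
[crux] uniform Schramm passage ⇒ identification of every subsequential weak limit of the critical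
SAW laws in (Ω_δ; a_δ, b_δ) as the chordal SLE_{8/3} law (the shared SubseqIdentification): (i)
Kemppainen–Smirnov data for the SAW (describability of limits, driver convergence; Condition G2),
(ii) the exact discrete martingale h_δ(z | γ[0,n]) = side probability in the slit cell domain ≈
Schramm functional of the discrete driver (by SPU, slit domains being cell domains), (iii) passage
to the limit for the time-limited Schramm functional and (iv) SchrammCharacterisesSLE. [deps:
SchrammPassageUniform, SubseqIdentification, SchrammCharacterisesSLE] [difficulty: XL] -/
@[route_item "route-CriticalPhenomena-SAWSchrammPassage", crux]
def SchrammIdentifies : Prop :=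
  SchrammPassageUniform → ∀ (D : Literature.Probability.RandomPlanarGeometry.DobrushinDomain) (a b : ℝ → Literature.Probability.LatticeModels.Site 2), Literature.Probability.RandomPlanarGeometry.SAW.IsEndpointApprox D a b → ∀ (s : ℕ → ℝ) (μ : MeasureTheory.Measure (Literature.Probability.RandomPlanarGeometry.CurveClass ℂ)), Filter.Tendsto s Filter.atTop (nhdsWithin 0 (Set.Ioi 0)) → MeasureTheory.IsProbabilityMeasure μ → (∀ f : BoundedContinuousFunction (Literature.Probability.RandomPlanarGeometry.CurveClass ℂ) ℝ, Filter.Tendsto (fun n => ∫ γ, f γ.curve ∂(Literature.Probability.RandomPlanarGeometry.SAW.law D.carrier (s n) (a (s n)) (b (s n)))) Filter.atTop (nhds (∫ x, f x ∂μ))) → Literature.Probability.RandomPlanarGeometry.IsSLELaw ((8 : NNReal) / 3) D μ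

/-- item stmt-CriticalPhenomena-19046 · crux · rank 6 · open · by planner
why it might fail: Analysis only, but the finite-data / normal-position typing must follow from compactness: a gap would be a bad sequence whose limit needs closure data the fixed ψ_i never see, or degenerates (arg Φₙ⁻¹zₙ → 0,π is covered by (i); unbounded kernel limits allowed) — not in print.
sources: Schramm2001Percolation, Pommerenke1992, Lawler2005, GilbargTrudinger2001
[crux] Schrödinger stability — the PURE-ANALYSIS half of ClosureToSchramm, typed in normal position
with finite test data (child 1/3 of the strategist's split; glue closureToSchramm_of_subs at
Cruxes/ClosureToSchramm/SplitGlue.lean): for all moduli ηB, NB, ρE, NE and every ε > 0 there exist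
finitely many test functions ψ_1..ψ_m ∈ C²_c(ℂ), a margin r, a tolerance η and a room N such that
for every mesh δ ≤ 1/N, Dobrushin domain D, conformal Φ : ℍ → D, point z with ‖z‖ ≤ δ, dist(z,∂D) =
1, ‖Φ⁻¹z‖ = 1, and EVERY function H : ℂ → [0,1] (no SAW) having (i) Schramm boundary values near the
two arcs with modulus (ηB, NB), (ii) macroscopic equicontinuity with modulus (ρE, NE) and (iii) |Σ_f
H Δ_δψ_i + ½ψ_i·π²|∇_δ(arg Φ⁻¹/π)|²·(2H−1)| ≤ η for those ψ_i with r-thickened support in D, one has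
|H z − (1 − index_D(z)·Re Φ⁻¹z)/2| ≤ ε. Informal proof: contradiction + compactness (Koebe/normal
families, Carathéodory kernel convergence, generalised Arzelà–Ascoli from (ii), weak equation in the
limit along a countable dense family, conformal invariance, elliptic regularity) and UNIQUENESS of
bounded solutions of u_tt + u_θθ + u = 0 on the strip ℝ×(0,π) with boundary values ∓index (modes sin
mθ·e^{±√ -/
@[route_item "route-CriticalPhenomena-SAWSchrammPassage", crux]
def SchrodingerStability : Prop :=
  ∀ (ηB : ℝ → ℝ) (NB : ℝ → ℕ) (ρE : ℝ → ℝ) (NE : ℝ → ℕ), (∀ e > (0 : ℝ), 0 < ηB e) → (∀ e > (0 : ℝ), 0 < ρE e) → ∀ ε > (0 : ℝ), ∃ (m : ℕ) (ψ : Fin m → ℂ → ℝ) (r η : ℝ) (N : ℕ), (∀ i, ContDiff ℝ 2 (ψ i)) ∧ (∀ i, HasCompactSupport (ψ i)) ∧ 0 < r ∧ 0 < η ∧ ∀ (δ : ℝ) (D : Literature.Probability.RandomPlanarGeometry.DobrushinDomain) (Φ : Literature.Probability.RandomPlanarGeometry.ConformalEquiv UpperHalfPlane.upperHalfPlaneSet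 D.carrier) (z : ℂ) (H : ℂ → ℝ), let c : Literature.Probability.LatticeModels.Site 2 → ℂ := fun f => Literature.Probability.LatticeModels.meshPoint δ f + ((δ / 2 : ℝ) : ℂ) * (1 + Complex.I); let ω : ℂ → ℝ := fun w => Complex.arg (Φ.symm w) / Real.pi; let E : Literature.Probability.LatticeModels.Site 2 → ℝ := fun f => Real.pi ^ 2 * ((ω (c (f + ![1, 0])) - ω (c f)) ^ 2 + (ω (c (f + ![0, 1])) - ω (c f)) ^ 2); let s : ℂ → ℝ := fun x => (1 - (D.index x : ℝ) * ((Φ.symm x).re / ‖Φ.symm x‖)) / 2; 0 < δ → z ∈ D.carrier → ‖z‖ ≤ δ → Metric.infDist z D.carrierᶜ = 1 → (N : ℝ) * δ ≤ 1 → ‖Φ.symm z‖ = 1 → (∀ x, 0 ≤ H x ∧ H x ≤ 1) → (∀ e > (0 : ℝ), ∀ x ∈ D.carrier, (NB e : ℝ) * δ ≤ Metric.infDist x D.carrierᶜ → (Complex.arg (Φ.symm x) ≤ ηB e ∨ Real.pi - ηB e ≤ Complex.arg (Φ.symm x)) → |H x - s x| ≤ e) → (∀ e > (0 : ℝ), ∀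 x x' : ℂ, x ∈ D.carrier → (NE e : ℝ) * δ ≤ Metric.infDist x D.carrierᶜ → ‖x' - x‖ ≤ ρE e * Metric.infDist x D.carrierᶜ → |H x - H x'| ≤ e) → (∀ i : Fin m, Metric.cthickening r (tsupport (ψ i)) ⊆ D.carrier → |∑' f : Literature.Probability.LatticeModels.Site 2, (H (c f) * Literature.Probability.LatticeModels.latticeLaplacian (fun g => ψ i (c g)) f + (1 / 2) * ψ i (c f) * E f * (2 * H (c f) - 1))| ≤ η) → |H z - (1 - (D.index z : ℝ) * (Φ.symm z).re) / 2| ≤ ε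

/-- item stmt-CriticalPhenomena-0783 · support · rank 9 · open · by planner
sources: LawlerSchrammWerner2004SAW, KemppainenSmirnov2017, route-CriticalPhenomena-SAWParafermion
[crux] r3: identification of subsequential limits — for every Dobrushin domain D, endpoint
approximation (a_δ,b_δ), sequence s_n → 0+ and probability measure μ on CurveClass ℂ, if ∫ f∘curve
d(Literature.Probability.RandomPlanarGeometry.SAW.law D (s n) …) → ∫ f dμ for all bounded continuous
f then μ is the chordal SLE_{8/3} law in D (Literature.Probability.RandomPlanarGeometry.IsSLELaw
(8/3) D μ). Obtained from r2 (observable limit) by the martingale principle (LSW03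
arXiv:math/0209343 Prop. 5.2: κ = 8/3 is singled out by the 5/8-observable), or from restriction
(sibling route). -/
@[route_item "route-CriticalPhenomena-SAWSchrammPassage"]
def SubseqIdentification : Prop :=
  ∀ (D : Literature.Probability.RandomPlanarGeometry.DobrushinDomain) (a b : ℝ → Literature.Probability.LatticeModels.Site 2), Literature.Probability.RandomPlanarGeometry.SAW.IsEndpointApprox D a b → ∀ (s : ℕ → ℝ) (μ : MeasureTheory.Measure (Literature.Probability.RandomPlanarGeometry.CurveClass ℂ)), Filter.Tendsto s Filter.atTop (nhdsWithin 0 (Set.Ioi 0)) → MeasureTheory.IsProbabilityMeasure μ → (∀ f : BoundedContinuousFunction (Literature.Probability.RandomPlanarGeometry.CurveClass ℂ) ℝ, Filter.Tendsto (fun n => ∫ γ, f γ.curve ∂(Literature.Probability.RandomPlanarGeometry.SAW.law D.carrier (s n) (a (s n)) (b (s n)))) Filter.atTop (nhds (∫ x, f x ∂μ))) → Literature.Probability.RandomPlanarGeometry.IsSLELaw ((8 : NNReal) / 3) D μ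

/-- item stmt-CriticalPhenomena-17594 · support · rank 9 · open · by planner
sources: Summits/CriticalPhenomena/SAWScalingLimit/Cruxes/ClosureToSchramm/SplitGlue.lean, LawlerSchrammWerner2004SAW, Beffara2008
[support] SPLIT GLUE of the deciding crux ClosureToSchramm (crux-strategist, BC2 redirect of the
RESTATED crux stmt-CriticalPhenomena-5597, 2026-08-17): SchrodingerStability → ArcBoundaryValues →
SideFieldEquicontinuity → ClosureToSchramm. PROVED: theorem
Summit.CriticalPhenomena.SAWScalingLimit.Theorems.ClosureToSchrammSplit.closureToSchramm_of_subs
(hypotheses = the three children's statements verbatim, conclusion = ClosureToSchramm by name; 635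
lines, lean check rc 0, 0 sorry, axioms propext/Classical.choice/Quot.sound). Proof: normalise each
cell configuration by the lattice similarity σx = (x − δv₀)/d (d = dist(z,∂D) ≥ Nδ, v₀ = nearest
site), which maps cell domains onto cell domains of mesh δ/d (image_simil_interior_cellSet) and
marks/adjacency/chordality along; apply TurningClosure, ArcBoundaryValues, SideFieldEquicontinuity
to the IMAGE configuration to discharge hypotheses (iii), (i), (ii) of SchrodingerStability for the
image side field at σz (normal position ‖σz‖ ≤ δ/d, dist = 1, ‖Φ''⁻¹σz‖ = 1, δ/d ≤ 1/N ≤ δ₀(ψᵢ) via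
N = N₀ + 1 + Σᵢ⌈δ₀(ψᵢ)⁻¹⌉); carry the bound back by the EXACT similarity covariance of the side
field (sideVal_simil: x ↦ x − v₀ is a graph isomorphism of d -/
@[route_item "route-CriticalPhenomena-SAWSchrammPassage", crux]
def ClosureToSchrammOfPieces : Prop :=
  SchrodingerStability → ArcBoundaryValues → SideFieldEquicontinuity → ClosureToSchramm

/-- item stmt-CriticalPhenomena-1881 · support · rank 9 · open · by planner
sources: KemppainenSmirnov2017, Summit.CriticalPhenomena.SAWScalingLimit.Theorems.SAWParafermionTight_refuted, route-CriticalPhenomena-SAWLeftRightFKG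
[support] EVENTUAL TIGHTNESS of the critical SAW laws: for every Dobrushin domain and endpoint
approximation, IsTightAlongMesh (fun δ γ => γ.curve) (fun δ => SAW.law D δ a_δ b_δ) — for every ε
some compact set of CurveClass ℂ carries all but ε of the mass for all small δ. This is the form the
Prokhorov criterion convergesInLawToSLE_of_isTightAlongMesh consumes and the repair of the refuted
all-δ Tight (IsTightLaws over δ ∈ (0,1]) suggested by the refuting theorem; offered to routes
SAWParafermion / SAWConfRestriction as their restated r3/r4. -/
@[route_item "route-CriticalPhenomena-SAWSchrammPassage", crux]
def EventualTight : Prop :=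
  ∀ (D : Literature.Probability.RandomPlanarGeometry.DobrushinDomain) (a b : ℝ → Literature.Probability.LatticeModels.Site 2), Literature.Probability.RandomPlanarGeometry.SAW.IsEndpointApprox D a b → Literature.Probability.RandomPlanarGeometry.IsTightAlongMesh (fun δ (γ : Literature.Probability.RandomPlanarGeometry.SAW.DomainSAW D.carrier δ (a δ) (b δ)) => γ.curve) (fun δ => Literature.Probability.RandomPlanarGeometry.SAW.law D.carrier δ (a δ) (b δ))

/-- item stmt-CriticalPhenomena-5599 · support · rank 9 · open · by planner
sources: Schramm2001Percolation, Kennedy2002, Kennedy2004, Pommerenke1992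
[support] the pointwise physical statement (cheapest-falsifier form; Kennedy's simulations): for
every Dobrushin (Jordan) domain D, chordal uniformizer Φ, endpoint approximation (a_δ, b_δ) and z ∈
Ω, P_δ[z enclosed by SAW polyline + [b_δ, b] + arc 1 + [a, a_δ]] → (1 − index_D(z)·cos arg Φ⁻¹(z))/2
as δ → 0⁺ (= sin²(θ/2) for the left bank, Schramm's cos²(θ/2) for the right bank). Follows from
SchrammPassageUniform by Carathéodory kernel convergence of the cell domains of Ω_δ to Ω; its
negation kills the line. [difficulty: open-problem] -/
@[route_item "route-CriticalPhenomena-SAWSchrammPassage"]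
def SchrammPassage : Prop :=
  ∀ (D : Literature.Probability.RandomPlanarGeometry.DobrushinDomain) (Φ : Literature.Probability.RandomPlanarGeometry.ConformalEquiv UpperHalfPlane.upperHalfPlaneSet D.carrier), D.IsChordalUniformizing Φ → ∀ (a b : ℝ → Literature.Probability.LatticeModels.Site 2), let L : (δ : ℝ) → Literature.Probability.RandomPlanarGeometry.SAW.DomainSAW D.carrier δ (a δ) (b δ) → ℝ → ℂ := fun δ γ t => if t ≤ 1 / 2 then (γ.walk.toCurve (Literature.Probability.LatticeModels.meshPoint δ)) (Set.projIcc (0 : ℝ) 1 zero_le_one (2 * t)) else if 2 * t - 1 ≤ 1 / 3 then Literature.Probability.LatticeModels.meshPoint δ (b δ) + ((3 * (2 * t - 1) : ℝ) : ℂ) * (D.pt 1 - Literature.Probability.LatticeModels.meshPoint δ (b δ)) else if 2 * t - 1 ≤ 2 / 3 then D.boundary (D.mark 1 + (3 * (2 * t - 1) - 1) * (D.mark 0 + 1 - D.mark 1)) else D.pt 0 + ((3 * (2 * t - 1) - 2 : ℝ) : ℂ) * (Literature.Probability.LatticeModels.meshPoint δ (a δ) - D.pt 0); Literature.Probability.RandomPlanarGeometry.SAW.IsEndpointApprox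 D a b → ∀ z ∈ D.carrier, Filter.Tendsto (fun δ : ℝ => (Literature.Probability.RandomPlanarGeometry.SAW.law D.carrier δ (a δ) (b δ) {γ | Literature.Topology.PlaneTopology.wind (fun t => L δ γ t - z) ≠ 0}).toReal) (nhdsWithin 0 (Set.Ioi 0)) (nhds ((1 - (D.index z : ℝ) * ((Φ.symm z).re / ‖Φ.symm z‖)) / 2))

/-- item stmt-CriticalPhenomena-5600 · support · rank 9 · open · by planner
sources: Schramm2001Percolation, CDHKSCRAS2014, RohdeSchramm2005, Literature.Probability.RandomPlanarGeometry.martingale_schrammObsStopped_sle, Literature.Probability.RandomPlanarGeometry.isSLELaw_of_isLocalMartingale_driving_of_lt_four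
[support] converse of Schramm's martingale (continuum, provable now with the tree's
far-field/localisation machinery): if ν is a probability law on curve classes a.e. driven through a
chordal uniformizer φ of (D; a, b) by a continuous process W (W₀ = 0, measurable marginals) and for
every z ∈ ℍ the time-limited Schramm observable S_{t ∧ Im(z)²/9}(z) = (1 + Re z_t/|z_t|)/2 satisfies
the cylinder identity E_ν[(S_t − S_s) ψ(W_S)] = 0, then ν is the chordal SLE_{8/3} law: far-field
expansion at z = R e^{iπ/4} gives W_t and W_t² − (8/3)t local martingales (on the imaginary axis the
second-order coefficient sin²φ cos φ vanishes, so off-axis points or third order −2∫W ds + W³/2 −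
2tW are needed), then isSLELaw_of_isLocalMartingale_driving_of_lt_four (PROVED, κ = 8/3 < 4).
[difficulty: M] -/
@[route_item "route-CriticalPhenomena-SAWSchrammPassage"]
def SchrammCharacterisesSLE : Prop :=
  ∀ (D : Literature.Probability.RandomPlanarGeometry.DobrushinDomain) (φ : Literature.Probability.RandomPlanarGeometry.ConformalEquiv UpperHalfPlane.upperHalfPlaneSet D.carrier), D.IsChordalUniformizing φ → ∀ (ν : MeasureTheory.Measure (Literature.Probability.RandomPlanarGeometry.CurveClass ℂ)), MeasureTheory.IsProbabilityMeasure ν → ∀ (W : Literature.Probability.RandomPlanarGeometry.CurveClass ℂ → NNReal → ℝ), (∀ t, MeasureTheory.StronglyMeasurable fun c => W c t) → (∀ c, Continuous (W c)) → (∀ c, W c 0 = 0) → (∀ᵐ c ∂ν, Literature.Probability.RandomPlanarGeometry.Loewner.IsDrivenBy φ.boundaryExtension (D.pt 1) (W c) c) → (∀ z : ℂ, 0 < z.im → ∀ s t : NNReal, s ≤ t → ∀ (n : ℕ) (S : Fin n → NNReal), (∀ k, S k ≤ s) → ∀ g : (Fin n → ℝ) → ℝ, Continuous g → (∀ v, |g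 v| ≤ 1) → ∫ c, (Literature.Probability.RandomPlanarGeometry.Loewner.schrammObs (W c) z (min t (z.im ^ 2 / 9).toNNReal) - Literature.Probability.RandomPlanarGeometry.Loewner.schrammObs (W c) z (min s (z.im ^ 2 / 9).toNNReal)) * g (fun k => W c (S k)) ∂ν = 0) → Literature.Probability.RandomPlanarGeometry.IsSLELaw ((8 : NNReal) / 3) D ν

-- earlier Assembly (stmt-CriticalPhenomena-5601, replaced 2026-08-15T16:53:41Z -> stmt-CriticalPhenomena-11228): retired by None — TurningClosure → ClosureToSchramm → SchrammIdentifies → EventualTight → SAWScalingLimit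
/-- item stmt-CriticalPhenomena-11228 · assembly · rank 1 · open · by planner
sources: Literature.Probability.RandomPlanarGeometry.convergesInLawToSLE_of_isTightAlongMesh, Literature.Probability.RandomPlanarGeometry.IsSLECurve.map_eq_holds, KemppainenSmirnov2017
[assembly] EventualTight → TurningClosure → ClosureToSchramm → SchrammIdentifies → SAWScalingLimit
(re-filed, hypotheses reordered, so that it materialises: the rev-0 item 5601 stayed BLOCKED on the
once-missing decl SchrammIdentifies). It is the type of the deciding theorem `closes` up to the
order of hypotheses (D-0027 §2.1): `fun hT h₁ h₂ h₃ => closes h₁ h₂ h₃ hT` proves it once the file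
carries `closes`. -/
@[route_item "route-CriticalPhenomena-SAWSchrammPassage"]
def Assembly : Prop :=
  EventualTight → TurningClosure → ClosureToSchramm → SchrammIdentifies → SAWScalingLimit

/-! D-0027 §2.1 — DECIDING THEOREM (planner-authored via `route open/edit --closes-file`; by planner-cstrat-stmt-CriticalPhenomena-5597-r1-0 2026-08-17T04:18:21Z):
its hypotheses are this route's items and its conclusion the sub-problem Statement (glue_lint), and it elaborates with this file. -/

@[closes "route-CriticalPhenomena-SAWSchrammPassage"] theorem closes (h₁ : TurningClosure) (hA : SchrodingerStability) (hB : ArcBoundaryValues)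
    (hE : SideFieldEquicontinuity) (hG : ClosureToSchrammOfPieces) (h₃ : SchrammIdentifies)
    (h₄ : EventualTight) : _root_.SAWScalingLimit := by
  classical
  -- the deciding crux `ClosureToSchramm` is DERIVED from its three typed pieces (strategist split,
  -- BC2 redirect 2026-08-17) through the glue item `ClosureToSchrammOfPieces`
  have h₂ : ClosureToSchramm := hG hA hB hE
  -- the chain of the route: turning closure ⇒ uniform Schramm passage ⇒ identification of every
  -- subsequential limit of the critical SAW laws as the chordal SLE(8/3) law
  have hId := h₃ (h₂ h₁)
  intro D a b hab
  have hI := hId D a b hab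
  have hT := h₄ D a b hab
  -- (1) positivity of the critical fugacity `x_c = 1/μ` (`μ ≥ 1`)
  have hxc : 0 < Literature.Probability.RandomPlanarGeometry.SAW.criticalFugacity := by
    rw [Literature.Probability.RandomPlanarGeometry.SAW.criticalFugacity]
    have hμ := Literature.Probability.RandomPlanarGeometry.SAW.Zd.connectiveConstant_pos 2
    rw [Literature.Probability.RandomPlanarGeometry.SAW.Zd.connectiveConstant_two] at hμ
    exact inv_pos.mpr hμ
  -- (2) for `δ > 0` there are finitely many SAWs of `Ω_δ` between two sites (supports are
  -- duplicate-free lists over the finite set `{u} ∪ Ω_δ`)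
  have hfinite : ∀ {δ : ℝ}, 0 < δ → ∀ u v : Literature.Probability.LatticeModels.Site 2,
      Finite (Literature.Probability.RandomPlanarGeometry.SAW.DomainSAW D.carrier δ u v) := by
    intro δ hδ u v
    have hTfin : (insert u (Literature.Probability.LatticeModels.meshDomain D.carrier δ)).Finite :=
      (Literature.Probability.LatticeModels.meshDomain_finite D.isBounded hδ).insert u
    haveI : Fintype ↥(insert u (Literature.Probability.LatticeModels.meshDomain D.carrier δ)) :=
      hTfin.fintype
    have key : ∀ {x y : Literature.Probability.LatticeModels.Site 2}
        (p : (Literature.Probability.LatticeModels.discreteDomainGraph D.carrier δ).Walk x y),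
        ∀ w ∈ p.support, w = x ∨ w ∈ Literature.Probability.LatticeModels.meshDomain D.carrier δ := by
      intro x y p
      induction p with
      | nil =>
        intro w hw
        rw [SimpleGraph.Walk.support_nil, List.mem_singleton] at hw
        exact Or.inl hw
      | cons h p ih =>
        intro w hw
        rw [SimpleGraph.Walk.support_cons, List.mem_cons] at hw
        rcases hw with hw | hw
        · exact Or.inl hw
        · rcases ih w hw with rfl | hw'
          · exact Or.inr (Literature.Probability.LatticeModels.discreteDomainGraph_adj_iff.1 h).2.2
          · exact Or.inr hw'
    have hsupp : ∀ γ : Literature.Probability.RandomPlanarGeometry.SAW.DomainSAW D.carrier δ u v,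
        ∀ w ∈ γ.walk.support,
          w ∈ insert u (Literature.Probability.LatticeModels.meshDomain D.carrier δ) := by
      intro γ w hw
      rcases key γ.walk w hw with rfl | hw'
      · exact Set.mem_insert _ _
      · exact Set.mem_insert_of_mem _ hw'
    let F : Literature.Probability.RandomPlanarGeometry.SAW.DomainSAW D.carrier δ u v →
        {l : List ↥(insert u (Literature.Probability.LatticeModels.meshDomain D.carrier δ)) //
          l.length ≤ Fintype.card ↥(insert u (Literature.Probability.LatticeModels.meshDomain D.carrier δ))} :=
      fun γ => ⟨γ.walk.support.pmap (fun w hw => ⟨w, hw⟩) (hsupp γ), by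
        have hnd : (γ.walk.support.pmap (fun w hw =>
            (⟨w, hw⟩ : ↥(insert u (Literature.Probability.LatticeModels.meshDomain D.carrier δ))))
            (hsupp γ)).Nodup := by
          refine List.Nodup.pmap ?_ γ.isPath.support_nodup
          intro a _ b _ h
          exact congrArg Subtype.val h
        exact hnd.length_le_card⟩
    haveI : Finite {l : List ↥(insert u (Literature.Probability.LatticeModels.meshDomain D.carrier δ)) //
        l.length ≤ Fintype.card ↥(insert u (Literature.Probability.LatticeModels.meshDomain D.carrier δ))} :=
      (List.finite_length_le _ _).to_subtype
    refine Finite.of_injective F fun γ γ' h => ?_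
    have h' := congrArg (fun l : {l : List ↥(insert u
        (Literature.Probability.LatticeModels.meshDomain D.carrier δ)) // l.length ≤ Fintype.card
          ↥(insert u (Literature.Probability.LatticeModels.meshDomain D.carrier δ))} =>
        l.1.map Subtype.val) h
    simp only [F, List.map_pmap, List.pmap_eq_map, List.map_id'] at h'
    rcases γ with ⟨p, hp⟩
    rcases γ' with ⟨q, hq⟩
    simp only at h'
    cases SimpleGraph.Walk.support_injective h'
    rfl
  -- (3) the critical SAW law is a probability measure for all small `δ > 0`
  have hprob : ∀ᶠ δ in 𝓝[>] (0 : ℝ), IsProbabilityMeasure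
      (Literature.Probability.RandomPlanarGeometry.SAW.law D.carrier δ (a δ) (b δ)) := by
    filter_upwards [hab.reachable, self_mem_nhdsWithin] with δ hreach hδ
    have hδ' : 0 < δ := hδ
    haveI := hfinite hδ' (a δ) (b δ)
    haveI : Fintype (Literature.Probability.RandomPlanarGeometry.SAW.DomainSAW D.carrier δ (a δ) (b δ)) :=
      Fintype.ofFinite _
    have htop : Literature.Probability.RandomPlanarGeometry.SAW.weight D.carrier δ (a δ) (b δ) Set.univ ≠ ⊤ := by
      rw [Literature.Probability.RandomPlanarGeometry.SAW.weight,
        Measure.sum_apply _ MeasurableSpace.measurableSet_top, tsum_fintype]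
      refine ENNReal.sum_ne_top.2 fun γ _ => ?_
      simp
    obtain ⟨p⟩ := hreach
    let γ₀ : Literature.Probability.RandomPlanarGeometry.SAW.DomainSAW D.carrier δ (a δ) (b δ) :=
      ⟨p.toPath, p.toPath.2⟩
    have hpos : Literature.Probability.RandomPlanarGeometry.SAW.weight D.carrier δ (a δ) (b δ) Set.univ ≠ 0 := by
      intro h0
      have h1 : Literature.Probability.RandomPlanarGeometry.SAW.weight D.carrier δ (a δ) (b δ) {γ₀} ≤
          Literature.Probability.RandomPlanarGeometry.SAW.weight D.carrier δ (a δ) (b δ) Set.univ :=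
        measure_mono (Set.subset_univ _)
      rw [h0, Literature.Probability.RandomPlanarGeometry.SAW.weight_singleton, nonpos_iff_eq_zero,
        ENNReal.ofReal_eq_zero] at h1
      have : 0 < Literature.Probability.RandomPlanarGeometry.SAW.criticalFugacity ^ γ₀.length :=
        pow_pos hxc _
      linarith
    constructor
    rw [Literature.Probability.RandomPlanarGeometry.SAW.law, Measure.smul_apply, smul_eq_mul,
      ENNReal.inv_mul_cancel hpos htop]
  -- (4) a mesh window `(0, δ₁)` of probability laws, and a reparametrised mesh `g` living in it
  obtain ⟨δ₁, hδ₁, hwin⟩ : ∃ δ₁ > (0 : ℝ), ∀ δ, 0 < δ → δ < δ₁ → IsProbabilityMeasure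
      (Literature.Probability.RandomPlanarGeometry.SAW.law D.carrier δ (a δ) (b δ)) := by
    rw [eventually_nhdsWithin_iff, Metric.eventually_nhds_iff] at hprob
    obtain ⟨ε, hε, hεp⟩ := hprob
    refine ⟨ε, hε, fun δ hδ hδε => hεp ?_ hδ⟩
    rwa [Real.dist_eq, sub_zero, abs_of_pos hδ]
  obtain ⟨g, hg, hgeq⟩ : ∃ g : ℝ → ℝ, (∀ δ, 0 < g δ ∧ g δ < δ₁) ∧ ∀ δ, 0 < δ → δ < δ₁ → g δ = δ := by
    refine ⟨fun δ => if 0 < δ ∧ δ < δ₁ then δ else δ₁ / 2, fun δ => ?_, fun δ hδ hδ' => if_pos ⟨hδ, hδ'⟩⟩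
    show 0 < (if 0 < δ ∧ δ < δ₁ then δ else δ₁ / 2) ∧ (if 0 < δ ∧ δ < δ₁ then δ else δ₁ / 2) < δ₁
    by_cases h : 0 < δ ∧ δ < δ₁
    · rw [if_pos h]; exact h
    · rw [if_neg h]; exact ⟨by positivity, by linarith⟩
  have hgev : ∀ᶠ δ in 𝓝[>] (0 : ℝ), g δ = δ :=
    Filter.mem_of_superset (Ioo_mem_nhdsGT hδ₁) fun δ hδ => hgeq δ hδ.1 hδ.2
  haveI hinst : ∀ δ, IsProbabilityMeasure
      (Literature.Probability.RandomPlanarGeometry.SAW.law D.carrier (g δ) (a (g δ)) (b (g δ))) :=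
    fun δ => hwin (g δ) (hg δ).1 (hg δ).2
  -- (5) the tree's Prokhorov criterion for the reparametrised family (probability laws at EVERY
  -- index), with uniqueness of the SLE law `IsSLECurve.map_eq_holds`
  have key : Literature.Probability.RandomPlanarGeometry.ConvergesInLawToSLE ((8 : NNReal) / 3) D
      (fun δ (γ : Literature.Probability.RandomPlanarGeometry.SAW.DomainSAW D.carrier (g δ) (a (g δ))
        (b (g δ))) => γ.curve)
      (fun δ => Literature.Probability.RandomPlanarGeometry.SAW.law D.carrier (g δ) (a (g δ)) (b (g δ))) := by
    refine Literature.Probability.RandomPlanarGeometry.convergesInLawToSLE_of_isTightAlongMesh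
      Literature.Probability.RandomPlanarGeometry.IsSLECurve.map_eq_holds
      (Eventually.of_forall fun δ =>
        Literature.Probability.RandomPlanarGeometry.SAW.aemeasurable_curve _ _ _ _) ?_ ?_
    · -- tightness transfers along `g δ = δ` (eventually)
      intro ε hε
      obtain ⟨K, hK, hev⟩ := hT ε hε
      refine ⟨K, hK, ?_⟩
      filter_upwards [hev, hgev] with δ hδK hδg
      exact (le_of_eq (congrArg (fun x : ℝ =>
        Literature.Probability.RandomPlanarGeometry.SAW.law D.carrier x (a x) (b x)
          ((fun γ : Literature.Probability.RandomPlanarGeometry.SAW.DomainSAW D.carrier x (a x) (b x) =>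
            γ.curve) ⁻¹' Kᶜ)) hδg)).trans hδK
    · -- identification of subsequential limits along the reparametrised meshes `g (s n)`
      rintro μ hμ ⟨s, hs, hlim⟩
      refine hI (fun n => g (s n)) μ ?_ hμ hlim
      exact hs.congr' ((hs.eventually hgev).mono fun n hn => hn.symm)
  -- (6) back to the original family: the laws agree with the reparametrised ones near `0⁺`
  obtain ⟨Γ, hΓ, -, hlaw⟩ := key
  refine ⟨Γ, hΓ, Eventually.of_forall fun δ =>
    Literature.Probability.RandomPlanarGeometry.SAW.aemeasurable_curve _ _ _ _, fun f => ?_⟩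
  refine (hlaw f).congr' ?_
  filter_upwards [hgev] with δ hδg
  exact congrArg (fun x : ℝ =>
    ∫ ω, f (ω : Literature.Probability.RandomPlanarGeometry.SAW.DomainSAW D.carrier x (a x) (b x)).curve
      ∂(Literature.Probability.RandomPlanarGeometry.SAW.law D.carrier x (a x) (b x))) hδg

end Summit.CriticalPhenomena.SAWScalingLimit.Theses.SAWSchrammPassage
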